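import Summits.NavierStokesRegularity.NavierStokesRegularity.Theorems.FilamentSkeletonRssKelvinGateAccretionMode
import Literature.Analysis.FluidPDE.BiotSavartCurlPair
import Literature.Analysis.FluidPDE.PoincareHomotopyOperator

/-!
# Route `FilamentSkeletonRss` · cruxes `TransverseReductionRJ` / `TransverseReduction1AR(mod)` — the CURL OF THE ACCRETION MODE `D_pj`, in closed form

Helper file (theorems only), `--supports stmt-NavierStokesRegularity-23920 --as helper` (also serves 23611's negative successor B2′: the matrix `M_jk = ⟪χΨ_j, curl D_k⟫` of
`flux_identity_of_forced_profile`, and S2a/S2b's vorticity-form borders); LEAD of 23611 / registrar of 23920, lane ns-filament-21221-p1 g14.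

With `z = y − x₀`, unit tangent `t`, `s = ⟪z, t⟫`, `q = ‖z‖² − s²` (squared distance to the tangent line) and the entire function `G = dslope (q ↦ 1 − e^{−q}) 0`
(`G(q) = (1 − e^{−q})/q`, `G(0) = 1`; `…KelvinGateAccretionMode`), the accretion mode is `D(y) = e^{−s²} G(q) · (t × z)` (`accretionMode_eq_dslope_form`) and
  **`curl D (y) = 2 e^{−s²} · ( e^{−q} · t + s·G(q) · (z − s·t) )`**  (`curl_accretionMode_dslope`, `curl_accretionMode`):
a Gaussian AXIAL core `2e^{−s²−q} t` plus a RADIAL part `2 s e^{−s²} G(q) z_⊥` with the algebraic tail `G(q) ∼ 1/q` — the mode's vorticity is NOT transversally localised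
(it cannot be: `D` adds circulation locally in `s`).  Ingredients: `curl_smul`, `curlCLM_crossCLM` (`curl (t × z) = 2t`), `curlCLM_smulRight_innerSL` (`∇Φ × ·`),
`cross_cross_right` (BAC−CAB), and `G(q) + q G′(q) = e^{−q}` (from `q G(q) = 1 − e^{−q}`).
HONEST FRAMING: calculus for a HYPOTHETICAL filament-type rotating-self-similar blow-up route (MODEL rung); nothing here bears on Navier–Stokes regularity, NOT proved.
-/

set_option linter.dupNamespace false

noncomputable section

namespace Summit.NavierStokesRegularity.NavierStokesRegularity.Theorems.KelvinGate

open Set Function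
open Literature.Analysis.FluidPDE
open scoped InnerProductSpace ContDiff Topology

/-- `q · G(q) = 1 − e^{−q}` for the `dslope` form `G` (all `q`). -/
theorem mul_dslope_one_sub_exp_neg (q : ℝ) : q * dslope (fun q : ℝ => 1 - Real.exp (-q)) 0 q = 1 - Real.exp (-q) := by
  by_cases hq : q = 0
  · subst hq; simp
  · rw [dslope_of_ne _ hq, slope_def_field]; simp only [neg_zero, Real.exp_zero, sub_self, sub_zero]; field_simp

/-- The derivative identity `G(q) + q·G′(q) = e^{−q}`. -/
theorem dslope_add_mul_deriv_eq_exp_neg (q : ℝ) :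
    dslope (fun q : ℝ => 1 - Real.exp (-q)) 0 q + q * deriv (dslope (fun q : ℝ => 1 - Real.exp (-q)) 0) q = Real.exp (-q) := by
  set G := dslope (fun q : ℝ => 1 - Real.exp (-q)) 0 with hG
  have hGd : DifferentiableAt ℝ G q := (analyticAt_dslope_one_sub_exp_neg q).differentiableAt
  have h1 : HasDerivAt (fun q : ℝ => q * G q) (1 * G q + q * deriv G q) q := (hasDerivAt_id q).mul hGd.hasDerivAt
  have h2 : HasDerivAt (fun q : ℝ => 1 - Real.exp (-q)) (Real.exp (-q)) q := by
    have h := ((hasDerivAt_neg q).exp).const_sub 1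
    simpa using h
  have e : (fun q : ℝ => q * G q) = fun q => 1 - Real.exp (-q) := funext fun q => mul_dslope_one_sub_exp_neg q
  rw [e] at h1
  have := h1.unique h2
  linarith

/-- **CURL OF THE ACCRETION MODE (dslope form).**  For a unit tangent `t` and base point `x₀`, at every `y` (notation `z = y − x₀`, `s = ⟪z,t⟫`, `q = ‖z‖² − s²`):
`curl (e^{−s²} G(q) · (t × z)) = 2e^{−s²} · (e^{−q} · t + s G(q) · (z − s·t))`. -/
theorem curl_accretionMode_dslope (x₀ t : EuclideanSpace ℝ (Fin 3)) (ht : ‖t‖ = 1) (y : EuclideanSpace ℝ (Fin 3)) :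
    curl (fun y : EuclideanSpace ℝ (Fin 3) => (Real.exp (-(⟪y - x₀, t⟫_ℝ) ^ 2) *
        dslope (fun q : ℝ => 1 - Real.exp (-q)) 0 (‖y - x₀‖ ^ 2 - ⟪y - x₀, t⟫_ℝ ^ 2)) • cross t (y - x₀)) y
      = (2 * Real.exp (-(⟪y - x₀, t⟫_ℝ) ^ 2)) • (Real.exp (-(‖y - x₀‖ ^ 2 - ⟪y - x₀, t⟫_ℝ ^ 2)) • t
          + (⟪y - x₀, t⟫_ℝ * dslope (fun q : ℝ => 1 - Real.exp (-q)) 0 (‖y - x₀‖ ^ 2 - ⟪y - x₀, t⟫_ℝ ^ 2)) • ((y - x₀) - ⟪y - x₀, t⟫_ℝ • t)) := by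
  -- notation
  set G := dslope (fun q : ℝ => 1 - Real.exp (-q)) 0 with hG
  set z : EuclideanSpace ℝ (Fin 3) := y - x₀ with hz
  set s : ℝ := ⟪y - x₀, t⟫_ℝ with hs
  set q : ℝ := ‖y - x₀‖ ^ 2 - ⟪y - x₀, t⟫_ℝ ^ 2 with hq
  -- the scalar factor and its derivative
  have htt : ⟪t, t⟫_ℝ = 1 := by rw [real_inner_self_eq_norm_sq, ht, one_pow]
  have hS : HasFDerivAt (fun y : EuclideanSpace ℝ (Fin 3) => ⟪y - x₀, t⟫_ℝ) (innerSL ℝ t) y := by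
    have e : (fun y : EuclideanSpace ℝ (Fin 3) => ⟪y - x₀, t⟫_ℝ) = fun y => innerSL ℝ t (y - x₀) := by
      funext y'; rw [innerSL_apply_apply, real_inner_comm]
    rw [e]
    exact ((innerSL ℝ t).hasFDerivAt.comp y ((hasFDerivAt_id y).sub_const x₀)).congr_fderiv (by ext h'; simp)
  have hN : HasFDerivAt (fun y : EuclideanSpace ℝ (Fin 3) => ‖y - x₀‖ ^ 2) (innerSL ℝ ((2:ℝ) • (y - x₀))) y :=
    (((hasFDerivAt_id y).sub_const x₀).norm_sq).congr_fderiv (by ext h'; simp)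
  have hQ : HasFDerivAt (fun y : EuclideanSpace ℝ (Fin 3) => ‖y - x₀‖ ^ 2 - ⟪y - x₀, t⟫_ℝ ^ 2)
      (innerSL ℝ ((2:ℝ) • (y - x₀)) - (2 * s) • innerSL ℝ t) y :=
    (hN.sub (hS.pow 2)).congr_fderiv (by ext h'; simp [hs])
  have hGd : HasDerivAt G (deriv G q) q := ((analyticAt_dslope_one_sub_exp_neg q).differentiableAt).hasDerivAt
  have hE : HasFDerivAt (fun y : EuclideanSpace ℝ (Fin 3) => Real.exp (-(⟪y - x₀, t⟫_ℝ) ^ 2))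
      ((Real.exp (-s ^ 2) * (-(2 * s))) • innerSL ℝ t) y :=
    ((hS.pow 2).neg.exp).congr_fderiv (by ext h'; simp [hs]; ring)
  have hΦ : HasFDerivAt (fun y : EuclideanSpace ℝ (Fin 3) => Real.exp (-(⟪y - x₀, t⟫_ℝ) ^ 2) * G (‖y - x₀‖ ^ 2 - ⟪y - x₀, t⟫_ℝ ^ 2))
      (Real.exp (-s ^ 2) • ((deriv G q) • (innerSL ℝ ((2:ℝ) • (y - x₀)) - (2 * s) • innerSL ℝ t))
        + G q • ((Real.exp (-s ^ 2) * (-(2 * s))) • innerSL ℝ t)) y := by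
    have h := hE.mul (hGd.comp_hasFDerivAt y hQ)
    refine h.congr_fderiv ?_
    simp only [hs, hq, Function.comp]
  -- collect: the derivative of the scalar factor is `innerSL g` with `g` the gradient
  have hΦ' : fderiv ℝ (fun y : EuclideanSpace ℝ (Fin 3) => Real.exp (-(⟪y - x₀, t⟫_ℝ) ^ 2) * G (‖y - x₀‖ ^ 2 - ⟪y - x₀, t⟫_ℝ ^ 2)) y
      = innerSL ℝ ((2 * Real.exp (-s ^ 2) * deriv G q) • (z - s • t) + (-(2 * s * Real.exp (-s ^ 2) * G q)) • t) := by
    rw [hΦ.fderiv]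
    ext h'
    simp only [FunLike.coe_add, Pi.add_apply, FunLike.coe_smul, Pi.smul_apply, FunLike.coe_sub, Pi.sub_apply, innerSL_apply_apply, smul_eq_mul,
      inner_add_left, inner_smul_left, inner_sub_left, RCLike.conj_to_real, hz]
    ring
  -- the cross field and its curl
  have hW : HasFDerivAt (fun y : EuclideanSpace ℝ (Fin 3) => cross t (y - x₀)) (crossCLM t) y := by
    have e : (fun y : EuclideanSpace ℝ (Fin 3) => cross t (y - x₀)) = fun y => crossCLM t (y - x₀) := by
      funext y'; rw [crossCLM_apply]
    rw [e]
    exact ((crossCLM t).hasFDerivAt.comp y ((hasFDerivAt_id y).sub_const x₀)).congr_fderiv (by ext h'; simp)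
  have hΦd : DifferentiableAt ℝ (fun y : EuclideanSpace ℝ (Fin 3) => Real.exp (-(⟪y - x₀, t⟫_ℝ) ^ 2) * G (‖y - x₀‖ ^ 2 - ⟪y - x₀, t⟫_ℝ ^ 2)) y :=
    hΦ.differentiableAt
  rw [curl_smul hΦd hW.differentiableAt, hΦ', curlCLM_smulRight_innerSL, curl_eq_curlCLM, hW.fderiv, curlCLM_crossCLM]
  -- cross-product algebra (BAC − CAB with ‖t‖ = 1)
  have hc1 : cross t (cross t z) = s • t - z := by
    rw [cross_cross_right, htt, one_smul, real_inner_comm, hz, hs]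
  have hzt : ⟪z - s • t, z⟫_ℝ = q := by
    rw [hz, hs, hq, inner_sub_left, inner_smul_left, real_inner_self_eq_norm_sq, real_inner_comm]
    simp; ring
  have hzt' : ⟪z - s • t, t⟫_ℝ = 0 := by
    rw [hz, hs, inner_sub_left, inner_smul_left, htt]; simp
  have hc2 : cross (z - s • t) (cross t z) = q • t := by
    rw [cross_cross_right, hzt, hzt', zero_smul, sub_zero]
  have hlin : cross ((2 * Real.exp (-s ^ 2) * deriv G q) • (z - s • t) + (-(2 * s * Real.exp (-s ^ 2) * G q)) • t) (cross t z)
      = (2 * Real.exp (-s ^ 2) * deriv G q) • cross (z - s • t) (cross t z) + (-(2 * s * Real.exp (-s ^ 2) * G q)) • cross t (cross t z) := by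
    rw [← crossCLM_apply, ← crossCLM_apply, ← crossCLM_apply, map_add, map_smul, map_smul]
    rfl
  have hzz : cross t (y - x₀) = cross t z := by rw [hz]
  rw [hzz, hlin, hc1, hc2]
  simp only [smul_smul]
  -- the `G + qG′ = e^{−q}` identity, then linear algebra
  have hGq : 2 * Real.exp (-s ^ 2) * deriv G q * q = 2 * Real.exp (-s ^ 2) * (Real.exp (-q) - G q) := by
    have h := dslope_add_mul_deriv_eq_exp_neg q
    rw [← hG] at h
    have : q * deriv G q = Real.exp (-q) - G q := by linarith
    calc 2 * Real.exp (-s ^ 2) * deriv G q * q = 2 * Real.exp (-s ^ 2) * (q * deriv G q) := by ring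
      _ = _ := by rw [this]
  rw [hGq, ← hs, ← hq]
  module

/-- **CURL OF THE ACCRETION MODE (the crux's `DefD` formula).**  Same closed form for the crux's own expression (Lean's `x/0 = 0` at `q = 0` is invisible). -/
theorem curl_accretionMode (x₀ t : EuclideanSpace ℝ (Fin 3)) (ht : ‖t‖ = 1) (y : EuclideanSpace ℝ (Fin 3)) :
    curl (fun y : EuclideanSpace ℝ (Fin 3) => (Real.exp (-(⟪y - x₀, t⟫_ℝ) ^ 2) *
        ((1 - Real.exp (-(‖y - x₀‖ ^ 2 - ⟪y - x₀, t⟫_ℝ ^ 2))) / (‖y - x₀‖ ^ 2 - ⟪y - x₀, t⟫_ℝ ^ 2))) • cross t (y - x₀)) y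
      = (2 * Real.exp (-(⟪y - x₀, t⟫_ℝ) ^ 2)) • (Real.exp (-(‖y - x₀‖ ^ 2 - ⟪y - x₀, t⟫_ℝ ^ 2)) • t
          + (⟪y - x₀, t⟫_ℝ * dslope (fun q : ℝ => 1 - Real.exp (-q)) 0 (‖y - x₀‖ ^ 2 - ⟪y - x₀, t⟫_ℝ ^ 2)) • ((y - x₀) - ⟪y - x₀, t⟫_ℝ • t)) := by
  rw [accretionMode_eq_dslope_form x₀ t ht]
  exact curl_accretionMode_dslope x₀ t ht y

end Summit.NavierStokesRegularity.NavierStokesRegularity.Theorems.KelvinGate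

end
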